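/-
Copyright (c) 2026 the pub-hodgecm-mathlib formalisation cell (harness21).  Prover seat hodgecm-mathlib-F0P3a-p07 (g11): road «S3-tree» (LEAD F0P3a-plan (g11); architect
A-p16 (g29) RULING A-66 «SPAN-0» (3): brick S-a3, FILE 1∕2 = the helpers), 2026-09-01.
-/
import Literature.NumberTheory.Automorphic.UnitaryLatticeTreeTypeTwoGram            -- ★ T1d′ (B-p14 (g35)): `isIntMatrix_mul`; brings the T1 chain (`mapGL_latt_eq`, `latt_le_iff_forall_mulVec_single_mem`, `mem_latt_diagonal_iff`, `isUnit_integer_iff`)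
import HarnessLib

/-!
# The lattice graph of a hermitian space — S-a3 helpers: INTEGRAL MATRICES WITH RESIDUALLY UNIPOTENT CHARACTERISTIC POLYNOMIAL, AND THE RESIDUAL ALGEBRA OF A
# UNIPOTENT ISOMETRY OF A HYPERBOLIC PLANE (Bruhat–Tits 1972 §10; Serre, *Trees* II.1.1)

Topic `NumberTheory/Automorphic`; namespace `Literature.NumberTheory.Automorphic.UnitaryLatticeTree`.  THEOREMS ONLY (no definition, no instance, no notation, no named fact,
no `sorry`).  Cell `pub/hodgecm-mathlib` (D-0151), crux H413 = `stmt-HodgeConjecture-24833`; road «S3-tree», brick S-a3 (architect A-p16 (g29) RULING A-66 (3)); this is FILE 1 of 2,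
the generic lemmas consumed by FILE 2 `UnitaryLatticeTreeTypeTwoUnipotentFixedNeighbour` («a residually unipotent element of a type-two vertex stabiliser fixes a self-dual
neighbour»).  CONTENTS: §1 powers of integral matrices (★ `isIntMatrix_mul`, B-p14); **`v_pow_sub_one_apply_lt_one`**: if `A` is integral and `charpoly A ≡ charpoly 1` coefficientwise mod `𝔪`
then `(A − 1)^N ≡ 0 mod 𝔪` entrywise (Cayley–Hamilton `aeval A (charpoly A) = 0`, `aeval A (charpoly 1) = (A − 1)^N`); the COLUMN TEST `v_apply_mul_le_of_mapGL_latt_diagonal_le`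
(`g·latt diag(d) ≤ latt diag(d) ⇒ |g_{ij}|·|d_j| ≤ |d_i|`).  §2 pure field identities (any field `k`): the `2 × 2` corner `[[Ā₀₀−1, Ā₀₂],[Ā₂₀, Ā₂₂−1]]` of a `3 × 3` matrix with
`(Ā − 1)³ = 0`, `Ā₁₀ = Ā₁₂ = 0` has trace and determinant `0` when `Ā₂₀ ≠ 0` (`residual_corner_trace_det`, Cayley–Hamilton in rank two), and `Ā₀₀ = 1` when `Ā₂₀ = 0`
(`residual_corner_eq_one_of_lower_zero`); **`residual_transvection_line`**: the isometry relations of a unipotent isometry `[[x, b],[c, y]]` of a hyperbolic hermitian plane (conjugate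
entries `X, Y, B, C`) force `ε′ = ε`, `C = −c` for `ε = x − 1`, hence `ε·C + ε′·c = 0` — the line `[ε : c]` is ISOTROPIC.  §3 `residue_eq_zero_iff_v_lt_one` (`x̄ = 0 ↔ |x| < 1` in
`𝒪[K]`), `residue_eq_of_v_sub_lt_one`.
HONEST LABEL: HC_CM is proved only modulo the 2 remaining named inputs (hLiu418 24832, h413 24833) until rung 0 closes; nothing printed is asserted here (elementary algebra).

## References
* [BruhatTits1972] F. Bruhat, J. Tits, *Groupes réductifs sur un corps local I*, Publ. Math. IHÉS 41 (1972), §10 (lattice models of classical groups; vertex stabilisers).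
* [Serre1980Trees] J.-P. Serre, *Trees* (1980), Ch. II §1.1 (lattices, integral matrices), §1.3 (integral characteristic polynomial).
* [Mok2014] C. P. Mok, *Endoscopic classification of representations of quasi-split unitary groups*, Mem. AMS 235 (2015), §1 Notation (the antidiagonal form `J₀`).
-/

set_option autoImplicit false

noncomputable section

open scoped Valued WithZero Matrix MatrixGroups
open Polynomial

namespace Literature.NumberTheory.Automorphic.UnitaryLatticeTree

open Literature.NumberTheory.Automorphic Literature.NumberTheory.Automorphic.HermitianLattice
open Literature.NumberTheory.Automorphic.CartanUnique

variable {K : Type*} [Field K] [Valued K ℤᵐ⁰] {σ : K →+* K} {ϖ : K} {N : ℕ}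

/-! ## §1 Integral matrices: products, powers, the residually unipotent power, the column test -/

/-- Powers of an integral matrix are integral. [cite: Serre1980Trees, II.1.1] -/
theorem isIntMatrix_pow {A : Matrix (Fin N) (Fin N) K} (hA : IsIntMatrix A) (k : ℕ) : IsIntMatrix (A ^ k) := by
  induction k with
  | zero =>
    intro i j
    rw [pow_zero, Matrix.one_apply]
    split_ifs <;> simp
  | succ k ih => rw [pow_succ]; exact isIntMatrix_mul ih hA

/-- **THE RESIDUALLY UNIPOTENT POWER**: if `A` is integral and `charpoly A ≡ charpoly 1` coefficientwise modulo `𝔪`, then every entry of `(A − 1)^N` lies in `𝔪`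
(Cayley–Hamilton: `(A − 1)^N = aeval A (charpoly 1 − charpoly A)`). [cite: BruhatTits1972, §10] -/
theorem v_pow_sub_one_apply_lt_one {A : Matrix (Fin N) (Fin N) K} (hA : IsIntMatrix A)
    (h1 : ∀ i, Valued.v (A.charpoly.coeff i - (1 : Matrix (Fin N) (Fin N) K).charpoly.coeff i) < 1) (j k : Fin N) :
    Valued.v (((A - 1) ^ N) j k) < 1 := by
  have hCH : aeval A A.charpoly = 0 := Matrix.aeval_self_charpoly A
  have hone : aeval A (1 : Matrix (Fin N) (Fin N) K).charpoly = (A - 1) ^ N := by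
    rw [Matrix.charpoly_one, map_pow, map_sub, aeval_X, map_one, Fintype.card_fin]
  have hdiff : (A - 1) ^ N = aeval A ((1 : Matrix (Fin N) (Fin N) K).charpoly - A.charpoly) := by
    rw [map_sub, hone, hCH, sub_zero]
  rw [hdiff, aeval_eq_sum_range, Matrix.sum_apply]
  refine Valuation.map_sum_lt _ one_ne_zero fun i _ => ?_
  rw [Matrix.smul_apply, smul_eq_mul, map_mul, coeff_sub]
  have hc : Valued.v ((1 : Matrix (Fin N) (Fin N) K).charpoly.coeff i - A.charpoly.coeff i) < 1 := by
    rw [← Valuation.map_neg, neg_sub]; exact h1 i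
  calc Valued.v ((1 : Matrix (Fin N) (Fin N) K).charpoly.coeff i - A.charpoly.coeff i) * Valued.v ((A ^ i) j k)
      ≤ Valued.v ((1 : Matrix (Fin N) (Fin N) K).charpoly.coeff i - A.charpoly.coeff i) * 1 :=
        mul_le_mul' le_rfl (isIntMatrix_pow hA i j k)
    _ < 1 := by rw [mul_one]; exact hc

/-- **COLUMN TEST**: if `g·latt diag(d) ≤ latt diag(d)` (`d_i ≠ 0`), then `|g_{ij}|·|d_j| ≤ |d_i|` (the columns of `g·diag(d)` lie in `latt diag(d)`). [cite: Serre1980Trees, II.1.1] -/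
theorem v_apply_mul_le_of_mapGL_latt_diagonal_le {d : Fin N → K} (hd : ∀ i, d i ≠ 0) {g : GL (Fin N) K}
    (h : mapGL g (latt (Matrix.diagonal d)) ≤ latt (Matrix.diagonal d)) (i j : Fin N) :
    Valued.v ((g : Matrix (Fin N) (Fin N) K) i j * d j) ≤ Valued.v (d i) := by
  have hle : latt ((g : Matrix (Fin N) (Fin N) K) * Matrix.diagonal d) ≤ latt (Matrix.diagonal d) := by rwa [← mapGL_latt_eq]
  have hcol := (latt_le_iff_forall_mulVec_single_mem _ _).1 hle j
  rw [Matrix.mulVec_single_one, mem_latt_diagonal_iff hd] at hcol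
  have := hcol i
  rwa [Matrix.col_apply, Matrix.mul_diagonal] at this

/-! ## §2 Residual algebra of a unipotent isometry of a hyperbolic plane (pure field identities) -/

section Residual

variable {k : Type*} [Field k]

omit [Valued K ℤᵐ⁰] in
/-- **THE `2 × 2` CORNER OF A RESIDUALLY UNIPOTENT `3 × 3` MATRIX IS NILPOTENT**: if `(Ā − 1)³ = 0` and `Ā₁₀ = Ā₁₂ = 0`, the corner `B̄ = [[Ā₀₀ − 1, Ā₀₂], [Ā₂₀, Ā₂₂ − 1]]`
has `B̄³ = 0`, hence — Cayley–Hamilton in rank two, `Ā₂₀ ≠ 0` — trace `0` and determinant `0`. [cite: BruhatTits1972, §10] -/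
theorem residual_corner_trace_det {A : Matrix (Fin 3) (Fin 3) k} (h3 : (A - 1) ^ 3 = 0) (h10 : A 1 0 = 0) (h12 : A 1 2 = 0) (h20 : A 2 0 ≠ 0) :
    (A 0 0 - 1) + (A 2 2 - 1) = 0 ∧ (A 0 0 - 1) * (A 2 2 - 1) - A 0 2 * A 2 0 = 0 := by
  have e20 : ((A - 1) ^ 3 : Matrix (Fin 3) (Fin 3) k) 2 0 = 0 := by rw [h3]; rfl
  have e00 : ((A - 1) ^ 3 : Matrix (Fin 3) (Fin 3) k) 0 0 = 0 := by rw [h3]; rfl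
  simp only [pow_succ, pow_zero, Matrix.one_mul, Matrix.mul_apply, Fin.sum_univ_three, Matrix.sub_apply, Matrix.one_apply, Fin.isValue,
    if_true, if_false, Fin.reduceEq, h10, h12, sub_zero] at e20 e00
  -- `s := tr B̄`, `p := det B̄`: `(B̄³)₂₀ = (s² − p)·Ā₂₀`, `(B̄³)₀₀ = (s² − p)(Ā₀₀ − 1) − s·p`
  have hsq : ((A 0 0 - 1 + (A 2 2 - 1)) ^ 2 - ((A 0 0 - 1) * (A 2 2 - 1) - A 0 2 * A 2 0)) * A 2 0 = 0 := by
    linear_combination e20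
  have hsq' : (A 0 0 - 1 + (A 2 2 - 1)) ^ 2 - ((A 0 0 - 1) * (A 2 2 - 1) - A 0 2 * A 2 0) = 0 :=
    (mul_eq_zero.1 hsq).resolve_right h20
  have hsp : (A 0 0 - 1 + (A 2 2 - 1)) * ((A 0 0 - 1) * (A 2 2 - 1) - A 0 2 * A 2 0) = 0 := by
    linear_combination (A 0 0 - 1) * hsq' - e00
  have hs3 : (A 0 0 - 1 + (A 2 2 - 1)) ^ 3 = 0 := by
    linear_combination (A 0 0 - 1 + (A 2 2 - 1)) * hsq' + hsp
  have hs : A 0 0 - 1 + (A 2 2 - 1) = 0 := pow_eq_zero_iff (n := 3) (by norm_num) |>.1 hs3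
  refine ⟨hs, ?_⟩
  linear_combination (-1 : k) * hsq' + (A 0 0 - 1 + (A 2 2 - 1)) * hs

omit [Valued K ℤᵐ⁰] in
/-- **LOWER-LEFT ZERO ⇒ `Ā₀₀ = 1`**: if `(Ā − 1)³ = 0`, `Ā₁₀ = Ā₁₂ = 0` and `Ā₂₀ = 0`, then `Ā₀₀ = 1` (the corner is upper triangular, `(B̄³)₀₀ = (Ā₀₀ − 1)³`). [cite: BruhatTits1972, §10] -/
theorem residual_corner_eq_one_of_lower_zero {A : Matrix (Fin 3) (Fin 3) k} (h3 : (A - 1) ^ 3 = 0) (h10 : A 1 0 = 0) (h12 : A 1 2 = 0) (h20 : A 2 0 = 0) :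
    A 0 0 - 1 = 0 := by
  have e00 : ((A - 1) ^ 3 : Matrix (Fin 3) (Fin 3) k) 0 0 = 0 := by rw [h3]; rfl
  simp only [pow_succ, pow_zero, Matrix.one_mul, Matrix.mul_apply, Fin.sum_univ_three, Matrix.sub_apply, Matrix.one_apply, Fin.isValue,
    if_true, if_false, Fin.reduceEq, h10, h12, h20, sub_zero] at e00
  have h : (A 0 0 - 1) ^ 3 = 0 := by linear_combination e00
  exact pow_eq_zero_iff (n := 3) (by norm_num) |>.1 h

omit [Valued K ℤᵐ⁰] in
/-- **THE FIXED LINE `[ε : c]` IS ISOTROPIC** (residual algebra of the transvection case): with `ε = x − 1`, `ε′ = X − 1` (`X, Y, B, C` the conjugate residues), trace and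
determinant of the corner zero on both sides, the isometry relations `B̄y + Ȳb = 0`, `X̄y + C̄b = 1`, and `b, c ≠ 0`: then `ε′ = ε`, `C = −c`, so `ε·C + ε′·c = 0`.
[cite: BruhatTits1972, §10] -/
theorem residual_transvection_line {x y b c X Y B C : k}
    (hS : (x - 1) + (y - 1) = 0) (hS' : (X - 1) + (Y - 1) = 0) (hR : (x - 1) * (y - 1) - b * c = 0) (hR' : (X - 1) * (Y - 1) - B * C = 0)
    (hE2 : B * y + Y * b = 0) (hE3 : X * y + C * b = 1) (hb : b ≠ 0) (hc : c ≠ 0) :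
    (x - 1) * C + (X - 1) * c = 0 := by
  have hbc : b * c = -(x - 1) ^ 2 := by linear_combination (-1 : k) * hR + (x - 1) * hS
  have hBC : B * C = -(X - 1) ^ 2 := by linear_combination (-1 : k) * hR' + (X - 1) * hS'
  have h1 : C * b = (x - 1) - (X - 1) + (x - 1) * (X - 1) := by linear_combination hE3 - X * hS
  have h2 : -C * (x - 1) ^ 2 = c * ((x - 1) - (X - 1) + (x - 1) * (X - 1)) := by linear_combination c * h1 - C * hbc
  have h3 : c * ((x - 1) - (X - 1)) = 0 := by
    linear_combination (c * C) * hE2 - (c * C * B) * hS - (c * C * b) * hS' - (c * (1 - (x - 1))) * hBC - (c * (1 - (X - 1))) * h1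
  have hEe : X - 1 = x - 1 := by
    have := (mul_eq_zero.1 h3).resolve_left hc
    linear_combination (-1 : k) * this
  have he2 : (x - 1) ^ 2 ≠ 0 := by
    intro h0
    apply mul_ne_zero hb hc
    rw [hbc, h0, neg_zero]
  have hC : C = -c := by
    have h4 : (C + c) * (x - 1) ^ 2 = 0 := by
      rw [hEe] at h2
      linear_combination (-1 : k) * h2
    have := (mul_eq_zero.1 h4).resolve_right he2
    linear_combination this
  rw [hC, hEe]; ring

end Residual

/-! ## §3 Residues in `𝓀[K]` -/

/-- The residue of `x ∈ 𝒪` vanishes iff `|x| < 1`. [cite: Serre1980Trees, II.1.1] -/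
theorem residue_eq_zero_iff_v_lt_one (x : 𝒪[K]) : IsLocalRing.residue 𝒪[K] x = 0 ↔ Valued.v (x : K) < 1 := by
  rw [IsLocalRing.residue_eq_zero_iff, IsLocalRing.mem_maximalIdeal, mem_nonunits_iff, isUnit_integer_iff]
  exact ⟨fun h => lt_of_le_of_ne x.2 h, fun h => ne_of_lt h⟩

/-- Two elements of `𝒪` with difference in `𝔪` have the same residue. [cite: Serre1980Trees, II.1.1] -/
theorem residue_eq_of_v_sub_lt_one {x y : 𝒪[K]} (h : Valued.v ((x : K) - y) < 1) : IsLocalRing.residue 𝒪[K] x = IsLocalRing.residue 𝒪[K] y := by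
  rw [← sub_eq_zero, ← map_sub, residue_eq_zero_iff_v_lt_one]
  exact h

end Literature.NumberTheory.Automorphic.UnitaryLatticeTree

end
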